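import Literature.AlgebraicGeometry.HodgeTheory.DivisorClassesFiniteEtaleBaseChange
import Literature.AlgebraicGeometry.Motives.FamiliesVHSLevelStructureUnipotentMonodromy
import HarnessLib

/-!
# «One is free to replace `S` by a finite etale covering `S' → S` … the local monodromy of `𝒱` … is unipotent»: the finite étale
# cover of level `3` for the data of a polarized variation of Hodge structure over a smooth quasi-projective complex variety,
# granted Riemann's existence theorem (Cattani–Deligne–Kaplan, «Proof of 1.5 ⟹ 1.1»)

Topic `Literature/AlgebraicGeometry/HodgeTheory` (namespace `Literature.AlgebraicGeometry.Motives.VHSData`), lane `lit-hodgefound` (seat `p08`,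
row g56-#9).  ONE THEOREM and a corollary (no definition, no named fact, no instance; D-0026 net debt `0`): the junction of
`Motives/FamiliesVHSLevelStructureUnipotentMonodromy` §4–§5 (the level-`3` subgroup of `π₁(S(ℂ), s)` has finite index; the level structure
pulls back along a map `φ` with `φ_* π₁ ≤ H` and is base-point free; level `≥ 3` and quasi-unipotent ⟹ unipotent) with the tree's
`HodgeTheory.exists_finiteEtale_of_finiteIndex_of_riemannExistence` (`HodgeTheory/DivisorClassesFiniteEtaleBaseChange`: granted SGA1 XII
Thm. 5.1 in the form of the named fact `FundamentalGroup.riemannExistence_finiteCovering`, a finite-index subgroup `H ≤ π₁(S(ℂ), s)` of a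
smooth irreducible quasi-projective `ℂ`-scheme `S` is dominated by a FINITE ÉTALE `g : S' ⟶ S` with `S'(ℂ)` path connected:
`g(ℂ)_* π₁(S'(ℂ), s') ≤ H`).

PRINTED SOURCE, VERBATIM.  E. Cattani, P. Deligne, A. Kaplan, *On the locus of Hodge classes*, J. Amer. Math. Soc. 8 (1995), «Proof of
1.5 ⟹ 1.1» (p. 485; held text `paper:arxiv-alg-geom_9402009` p0002): «To prove 1.1 one is free to replace `S` of 1.1 by a finite etale
covering `S' → S`. We may and shall assume that the monodromy mod `k` of `𝒱` is trivial, for some `k ≥ 3`. Let `S̄` be a smooth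
compactification of `S`, with `S̄ − S` a divisor with normal crossings. The assumption on the monodromy ensures that the local monodromy of
`𝒱` at infinity is unipotent» — with A. Borel, *Introduction aux groupes arithmétiques*, Prop. 17.4 (level `≥ 3` ⟹ neat; neat and
quasi-unipotent ⟹ unipotent) and SGA1 XII Thm. 5.1 (finite étale covers of `S` ≃ finite topological covers of `S(ℂ)`).

* **`VHSData.exists_finiteEtale_forall_isNilpotent_transport_sub_one_of_riemannExistence`** — for the data `D : VHSData (S(ℂ)) n` of a
  polarized `ℤ`VHS on the complex points of a smooth irreducible quasi-projective `ℂ`-scheme `S` and `s ∈ S(ℂ)`, GRANTED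
  `riemannExistence_finiteCovering`: there are a finite étale `g : S' ⟶ S` with `S'(ℂ)` path connected and a point of `S'(ℂ)` over `s`
  such that, for the pulled-back datum `g(ℂ)* D` on `S'(ℂ)`, at EVERY point `t' ∈ S'(ℂ)` and along EVERY loop `γ'` at `t'` whose
  (rational) monodromy `T = γ'_*` is quasi-unipotent (`T^a − 1` nilpotent for some `a ≥ 1` — what the monodromy theorem gives for the loops
  around the divisor at infinity of a good compactification of `S'`), `T − 1` is nilpotent: THE LOCAL MONODROMY OF `g* 𝒱` IS UNIPOTENT
  wherever it is quasi-unipotent.  (`g` is the cover of the level-`3` subgroup of the integral monodromy at `s`.)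
* `…_of_forall_norm_eq_one` — the same with quasi-unipotence supplied in its arithmetic form: every complex eigenvalue of the INTEGRAL
  monodromy of `g(ℂ)* D` along `γ'` has modulus `1` (Kronecker; the tree's `Literature/LinearAlgebra/Matrix/IntegerMatrixUnitCircleEigenvaluesQuasiUnipotent`
  through `isNilpotent_transport_sub_one_of_level_of_forall_norm_eq_one` is not needed: quasi-unipotence of the integral monodromy follows
  and is transferred to `V` by `isNilpotent_transport_pow_sub_one_iff`).

HONEST SCOPE.  Conditional on the named fact `FundamentalGroup.riemannExistence_finiteCovering` (SGA1 XII 5.1; Grauert–Remmert + GAGA, not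
provable in the tree today) exactly as the tree's cover theorem is; the monodromy theorem (quasi-unipotence at infinity) remains a hypothesis on
each loop; the smooth compactification `S̄'` with normal crossings (Hironaka) and the rest of CDK's proof are not touched.  The fundamental
groups are those of the subspaces `univ ⊆ S(ℂ)`, `univ ⊆ S'(ℂ)` inside the proof (the tree's convention for coverings), invisible in the
statement.

## References

* [CattaniDeligneKaplan1995] E. Cattani, P. Deligne, A. Kaplan, *On the locus of Hodge classes*, J. Amer. Math. Soc. 8 (1995) 483–506:
  «Proof of 1.5 ⟹ 1.1» (p. 485).
* [SGA1] A. Grothendieck, M. Raynaud, *Revêtements étales et groupe fondamental* (SGA 1), LNM 224, Exp. XII Thm. 5.1 (p. 333).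
* [Borel1969] A. Borel, *Introduction aux groupes arithmétiques* (Hermann, 1969), §17.1, Prop. 17.4.
* [HatcherAT2002] A. Hatcher, *Algebraic Topology* (CUP, 2002), §1.3 Prop. 1.36, Prop. 1.32.
* [CattaniElZeinGriffithsLe2014] E. Cattani, F. El Zein, P. Griffiths, Lê D. T. (eds.), *Hodge Theory*, Math. Notes 49 (2014), Thm. 7.5.1.
-/

noncomputable section

open CategoryTheory AlgebraicGeometry
open Polynomial

namespace Literature.AlgebraicGeometry.Motives.VHSData

open Literature.AlgebraicGeometry.HodgeTheory

variable {n : ℤ}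

/-- **Cattani–Deligne–Kaplan, «Proof of 1.5 ⟹ 1.1», the finite étale cover (granted Riemann's existence theorem).**  Let `S` be a smooth
irreducible quasi-projective `ℂ`-scheme, `D` the data of a polarized `ℤ`VHS on `S(ℂ)` and `s ∈ S(ℂ)`.  Granted
`FundamentalGroup.riemannExistence_finiteCovering` (SGA1 XII Thm. 5.1), there are a FINITE ÉTALE `g : S' ⟶ S` with `S'(ℂ)` path connected
and a point of `S'(ℂ)` over `s` — the cover attached to the (finite-index) subgroup of `π₁(S(ℂ), s)` along which the integral monodromy is
`≡ 1 (mod 3)` — such that for the pulled-back datum `g(ℂ)* D`: at every `t' ∈ S'(ℂ)`, along every loop `γ'` at `t'` whose monodromy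
`T = γ'_* ∈ Aut(V_{g(ℂ) t'})` is quasi-unipotent (`T^a − 1` nilpotent for some `a ≥ 1`), `T − 1` is nilpotent («the assumption on the
monodromy ensures that the local monodromy of `𝒱` at infinity is unipotent»). [cite: CattaniDeligneKaplan1995, «Proof of 1.5 ⟹ 1.1» (p. 485)]
[cite: SGA1, Exp. XII Thm. 5.1 (p. 333)] [cite: Borel1969, §17.1 and Prop. 17.4] [cite: HatcherAT2002, §1.3 Prop. 1.36] -/
theorem exists_finiteEtale_forall_isNilpotent_transport_sub_one_of_riemannExistence
    (hRE : FundamentalGroup.riemannExistence_finiteCovering) (S : SchemeOver ℂ) (hS : IsQuasiProjectiveOver S) [IrreducibleSpace S.left]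
    (d : ℕ) [SmoothOfRelativeDimension d S.hom] (D : VHSData (ComplexPoints S) n) (s : ComplexPoints S) :
    ∃ (S' : SchemeOver ℂ) (g : S' ⟶ S), IsFinite g.left ∧ Etale g.left ∧ PathConnectedSpace (ComplexPoints S') ∧
      (∃ s' : ComplexPoints S', AlgPoints.map g s' = s) ∧
      ∀ (t' : ComplexPoints S') (γ' : Path.Homotopic.Quotient t' t') (a : ℕ), 0 < a →
        IsNilpotent ((D.comap (AlgPoints.mapContinuous g)).V.transport γ' ^ a - 1) →
          IsNilpotent ((D.comap (AlgPoints.mapContinuous g)).V.transport γ' - 1) := by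
  -- the datum on the subspace `univ ⊆ S(ℂ)` (the tree's convention for `π₁` and coverings) and its level-`3` subgroup at `s` (§4–§5)
  let valS : C((Set.univ : Set (ComplexPoints S)), ComplexPoints S) := ⟨Subtype.val, continuous_subtype_val⟩
  obtain ⟨H, hH, hjunction⟩ :=
    (D.comap valS).exists_finiteIndex_forall_comap_isNilpotent_transport_sub_one ⟨s, Set.mem_univ s⟩
  haveI := hH
  -- Riemann existence: the finite étale cover dominated by `H`
  obtain ⟨S', g, s', hs, hfin, het, hpc, hloop⟩ := exists_finiteEtale_of_finiteIndex_of_riemannExistence hRE S hS d s H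
  refine ⟨S', g, hfin, het, hpc, ⟨s', hs⟩, ?_⟩
  haveI := hpc
  haveI : PathConnectedSpace (Set.univ : Set (ComplexPoints S')) := isPathConnected_iff_pathConnectedSpace.mp isPathConnected_univ
  -- the induced map of the subspaces `univ` and the domination `g(ℂ)_* π₁(S'(ℂ), s') ≤ H`
  let φ' : C((Set.univ : Set (ComplexPoints S')), (Set.univ : Set (ComplexPoints S))) :=
    ⟨fun x => ⟨AlgPoints.map g x.1, Set.mem_univ _⟩,
      ((AlgPoints.continuous_map g).comp continuous_subtype_val).subtype_mk fun _ => Set.mem_univ _⟩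
  have hs' : φ' ⟨s', Set.mem_univ s'⟩ = ⟨s, Set.mem_univ s⟩ := Subtype.ext hs
  have hrange : (FundamentalGroup.mapOfEq φ' hs').range ≤ H := by
    rintro _ ⟨γ'', rfl⟩
    induction γ'' using Path.Homotopic.Quotient.ind with
    | mk q =>
      rw [FundamentalGroup.mapOfEq_apply]
      exact hloop q
  intro t' γ'
  have key := hjunction φ' ⟨s', Set.mem_univ s'⟩ hs' hrange (PathConnectedSpace.joined _ ⟨t', Set.mem_univ t'⟩)
  -- from loops of the subspace `univ ⊆ S'(ℂ)` to loops of `S'(ℂ)`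
  induction γ' using Path.Homotopic.Quotient.ind with
  | mk p =>
    intro a ha hqu
    have hk : Continuous fun x : ComplexPoints S' => (⟨x, Set.mem_univ x⟩ : (Set.univ : Set (ComplexPoints S'))) :=
      continuous_id.subtype_mk _
    have e : ((D.comap valS).comap φ').V.transport (Path.Homotopic.Quotient.mk (p.map hk)) =
        (D.comap (AlgPoints.mapContinuous g)).V.transport (Path.Homotopic.Quotient.mk p) := rfl
    have := key (Path.Homotopic.Quotient.mk (p.map hk)) a ha
    rw [e] at this
    exact this hqu

/-- **The same with the quasi-unipotence in arithmetic form**: along every loop `γ'` of `S'(ℂ)` such that every complex eigenvalue of the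
INTEGRAL monodromy of `g(ℂ)* D` (every complex root of its characteristic polynomial over `ℤ`) has modulus `1` — the arithmetic half of the
monodromy theorem — the monodromy `T` on `V` has `T − 1` nilpotent (Kronecker: such an integral matrix is quasi-unipotent, the tree's
`Matrix.isNilpotent_pow_sub_one_of_forall_norm_eq_one` through `LinearMap`; then the theorem above).
[cite: CattaniDeligneKaplan1995, «Proof of 1.5 ⟹ 1.1» (p. 485)] [cite: Borel1969, Prop. 17.4] [cite: CattaniElZeinGriffithsLe2014, Thm. 7.5.1] -/
theorem exists_finiteEtale_forall_isNilpotent_transport_sub_one_of_riemannExistence_of_forall_norm_eq_one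
    (hRE : FundamentalGroup.riemannExistence_finiteCovering) (S : SchemeOver ℂ) (hS : IsQuasiProjectiveOver S) [IrreducibleSpace S.left]
    (d : ℕ) [SmoothOfRelativeDimension d S.hom] (D : VHSData (ComplexPoints S) n) (s : ComplexPoints S) :
    ∃ (S' : SchemeOver ℂ) (g : S' ⟶ S), IsFinite g.left ∧ Etale g.left ∧ PathConnectedSpace (ComplexPoints S') ∧
      (∃ s' : ComplexPoints S', AlgPoints.map g s' = s) ∧
      ∀ (t' : ComplexPoints S') [Module.Free ℤ ((D.comap (AlgPoints.mapContinuous g)).VZ.fiber t')]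
        [Module.Finite ℤ ((D.comap (AlgPoints.mapContinuous g)).VZ.fiber t')] (γ' : Path.Homotopic.Quotient t' t'),
        (∀ w : ℂ, aeval w ((D.comap (AlgPoints.mapContinuous g)).VZ.transport γ').charpoly = 0 → ‖w‖ = 1) →
          IsNilpotent ((D.comap (AlgPoints.mapContinuous g)).V.transport γ' - 1) := by
  obtain ⟨S', g, hfin, het, hpc, hs', h⟩ := D.exists_finiteEtale_forall_isNilpotent_transport_sub_one_of_riemannExistence hRE S hS d s
  refine ⟨S', g, hfin, het, hpc, hs', fun t' _ _ γ' hw => ?_⟩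
  obtain ⟨a, ha, hqu⟩ := ((D.comap (AlgPoints.mapContinuous g)).VZ.transport γ').exists_isNilpotent_pow_sub_one_of_forall_norm_eq_one hw
  exact h t' γ' a ha (((D.comap (AlgPoints.mapContinuous g)).isNilpotent_transport_pow_sub_one_iff γ' a).2 hqu)

end Literature.AlgebraicGeometry.Motives.VHSData

end
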